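import Literature.MathematicalPhysics.QuantumFieldTheory.LatticeLangevinDynamics
import Mathlib.MeasureTheory.Measure.Prod
import Mathlib.MeasureTheory.Measure.WithDensity
import Mathlib.MeasureTheory.Measure.Lebesgue.Basic
import HarnessLib

/-!
# Route `TransportPerturbation`, LINE 10 «harris_hybrid» (crux K1 `LyapunovContraction`, stmt-QuantumFields-26986; organ
# `RegularPairOverlap` 27873, rung `FixedCutoffOverlap`): the RANDOMISED SELECTOR of a Doeblin coupling in map form —
# acceptance probabilities on `[0,1]` and the law of the selector

Helper file (seat `ym-line-csu-p1`, g11, free hands; CSU lead memo g10 §3(b)(ii)), part 1 of 2 (part 2: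
`…DoeblinCoupling`).  Given a probability space `(Ω', μ)`, a measurable `S : Ω' → X` with law `q · π` for a reference
probability `π` on `X` and a measurable density `q ≥ c` (`π`-a.e.), the **randomised selector**

  `T(ω', (z, ξ)) := if ξ · q(S ω') ≤ c then z else S ω'`   on `Ω' × (X × [0,1])`, measure `μ ⊗ (π ⊗ Leb|[0,1])`,

replaces the sample `S ω'` by a FRESH `π`-sample `z` with conditional probability `c / q(S ω')`:

* `mul_volume_acc`, `mul_volume_acc_compl` — `a · Leb{ξ ∈ [0,1] : ξ a ≤ c} = min a c`, `a · Leb{¬…} = a − min a c`;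
* `mul_volume_acc_le_inter` — `m(a) m(b) ≤ Leb(acc a ∩ acc b)` (the acceptance sets are nested initial segments);
* `measurable_select`, `preimage_select_section`, `measure_select_section` — measurability and sections;
* ★ `map_select_eq` — the selector has law `q · π` again (`a·m(a) = c` and `a·(1 − m(a)) = a − c` a.e., Fubini over the
  sections, `∫_A (q − c) dπ + c π(A) = ∫_A q dπ`);
* `lintegral_volume_acc_eq` — the mean acceptance probability is exactly `c`.

Generic measurable spaces; THEOREMS ONLY, [folklore] (Doeblin / Nummelin splitting in map form, e.g. Roberts–Rosenthal,
Probab. Surveys 1 (2004) §4.2); no crux, rung or summit is proved here; the Yang–Mills mass gap is NOT proved.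
-/

set_option autoImplicit false

noncomputable section

namespace Summit.QuantumFields.YangMills.Theorems.TransportPerturbation.DoeblinCoupling

open MeasureTheory Set
open scoped ENNReal

/-! ## The acceptance event on `[0,1]` -/

section OneDim

/-- The acceptance set `{ξ : ξ·a ≤ c}` is measurable. [folklore] -/
theorem measurableSet_acc (a c : ℝ≥0∞) : MeasurableSet {ξ : ℝ | ENNReal.ofReal ξ * a ≤ c} :=
  measurableSet_le (ENNReal.measurable_ofReal.mul_const a) measurable_const

/-- The acceptance region `{(a, ξ) : ξ·a ≤ c}` is measurable in the pair. [folklore] -/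
theorem measurableSet_acc_prod (c : ℝ≥0∞) : MeasurableSet {q : ℝ≥0∞ × ℝ | ENNReal.ofReal q.2 * q.1 ≤ c} :=
  measurableSet_le ((ENNReal.measurable_ofReal.comp measurable_snd).mul measurable_fst) measurable_const

/-- `a ↦ Leb|[0,1] {ξ : ξ·a ≤ c}` is measurable. [folklore] -/
theorem measurable_volume_acc (c : ℝ≥0∞) :
    Measurable fun a : ℝ≥0∞ => (volume.restrict (Icc (0 : ℝ) 1)) {ξ : ℝ | ENNReal.ofReal ξ * a ≤ c} :=
  measurable_measure_prodMk_left (measurableSet_acc_prod c)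

/-- ★ **The acceptance probability**: `a · Leb{ξ ∈ [0,1] : ξ·a ≤ c} = min a c` (`a, c` finite). [folklore] -/
theorem mul_volume_acc (a c : ℝ≥0∞) (ha : a ≠ ⊤) (hc : c ≠ ⊤) :
    a * (volume.restrict (Icc (0 : ℝ) 1)) {ξ : ℝ | ENNReal.ofReal ξ * a ≤ c} = min a c := by
  by_cases ha0 : a = 0
  · subst ha0
    simp
  -- `0 < a < ⊤`: the accepted `ξ ∈ [0,1]` are `ξ ≤ (c/a).toReal`
  have hca : c / a ≠ ⊤ := (ENNReal.div_lt_top hc ha0).ne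
  have hset : {ξ : ℝ | ENNReal.ofReal ξ * a ≤ c} ∩ Icc (0 : ℝ) 1 = Icc 0 (min 1 (c / a).toReal) := by
    ext ξ
    simp only [mem_inter_iff, mem_setOf_eq, mem_Icc, le_min_iff]
    constructor
    · rintro ⟨h, h0, h1⟩
      refine ⟨h0, h1, ?_⟩
      rw [← ENNReal.ofReal_le_iff_le_toReal hca]
      exact (ENNReal.le_div_iff_mul_le (Or.inl ha0) (Or.inl ha)).2 h
    · rintro ⟨h0, h1, h⟩
      refine ⟨?_, h0, h1⟩
      exact (ENNReal.le_div_iff_mul_le (Or.inl ha0) (Or.inl ha)).1 ((ENNReal.ofReal_le_iff_le_toReal hca).2 h)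
  rw [Measure.restrict_apply (measurableSet_acc a c), hset, Real.volume_Icc, sub_zero]
  rcases le_total 1 (c / a) with h | h
  · -- everything accepted: `a ≤ c`
    have hr : min 1 (c / a).toReal = 1 := by
      refine min_eq_left ?_
      have := ENNReal.toReal_mono hca h
      simpa using this
    rw [hr, ENNReal.ofReal_one, mul_one]
    have hac : a ≤ c := by
      have := (ENNReal.le_div_iff_mul_le (Or.inl ha0) (Or.inl ha)).1 h
      simpa using this
    rw [min_eq_left hac]
  · -- partial acceptance: `c ≤ a`
    have hr : min 1 (c / a).toReal = (c / a).toReal := by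
      refine min_eq_right ?_
      have := ENNReal.toReal_mono ENNReal.one_ne_top h
      simpa using this
    rw [hr, ENNReal.ofReal_toReal hca, ENNReal.mul_div_cancel ha0 ha]
    have hca' : c ≤ a := by
      have := (ENNReal.div_le_iff_le_mul (Or.inl ha0) (Or.inl ha)).1 h
      simpa using this
    rw [min_eq_right hca']

/-- The rejection probability: `a · Leb{ξ ∈ [0,1] : ¬ ξ·a ≤ c} = a − min a c`. [folklore] -/
theorem mul_volume_acc_compl (a c : ℝ≥0∞) (ha : a ≠ ⊤) (hc : c ≠ ⊤) :
    a * (volume.restrict (Icc (0 : ℝ) 1)) {ξ : ℝ | ENNReal.ofReal ξ * a ≤ c}ᶜ = a - min a c := by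
  haveI : IsProbabilityMeasure (volume.restrict (Icc (0 : ℝ) 1)) := ⟨by simp⟩
  rw [prob_compl_eq_one_sub (measurableSet_acc a c), ENNReal.mul_sub (fun _ _ => ha), mul_one, mul_volume_acc a c ha hc]

/-- Monotonicity of acceptance: a larger density is accepted on a smaller set. [folklore] -/
theorem acc_subset_acc {a b : ℝ≥0∞} (hab : a ≤ b) (c : ℝ≥0∞) :
    {ξ : ℝ | ENNReal.ofReal ξ * b ≤ c} ⊆ {ξ : ℝ | ENNReal.ofReal ξ * a ≤ c} := fun _ hξ =>
  le_trans (mul_le_mul' le_rfl hab) hξ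

/-- Joint acceptance dominates the product of the acceptance probabilities: `m(a) m(b) ≤ Leb(acc a ∩ acc b)`. [folklore] -/
theorem mul_volume_acc_le_inter (a b c : ℝ≥0∞) :
    (volume.restrict (Icc (0 : ℝ) 1)) {ξ : ℝ | ENNReal.ofReal ξ * a ≤ c} *
        (volume.restrict (Icc (0 : ℝ) 1)) {ξ : ℝ | ENNReal.ofReal ξ * b ≤ c} ≤
      (volume.restrict (Icc (0 : ℝ) 1)) ({ξ : ℝ | ENNReal.ofReal ξ * a ≤ c} ∩ {ξ : ℝ | ENNReal.ofReal ξ * b ≤ c}) := by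
  haveI : IsProbabilityMeasure (volume.restrict (Icc (0 : ℝ) 1)) := ⟨by simp⟩
  rcases le_total a b with h | h
  · rw [inter_eq_right.2 (acc_subset_acc h c)]
    calc _ ≤ 1 * (volume.restrict (Icc (0 : ℝ) 1)) {ξ : ℝ | ENNReal.ofReal ξ * b ≤ c} :=
          mul_le_mul' prob_le_one le_rfl
      _ = _ := one_mul _
  · rw [inter_eq_left.2 (acc_subset_acc h c)]
    calc _ ≤ (volume.restrict (Icc (0 : ℝ) 1)) {ξ : ℝ | ENNReal.ofReal ξ * a ≤ c} * 1 :=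
          mul_le_mul' le_rfl prob_le_one
      _ = _ := mul_one _

end OneDim

/-! ## The randomised selector and its law -/

section Select

variable {X : Type*} [MeasurableSpace X] {Ω' : Type*} [MeasurableSpace Ω']

/-- The selector `(ω', (z, ξ)) ↦ if ξ·q(S ω') ≤ c then z else S ω'` is measurable. [folklore] -/
theorem measurable_select {S : Ω' → X} (hS : Measurable S) {q : X → ℝ≥0∞} (hq : Measurable q) (c : ℝ≥0∞) :
    Measurable fun p : Ω' × (X × ℝ) => if ENNReal.ofReal p.2.2 * q (S p.1) ≤ c then p.2.1 else S p.1 := by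
  refine Measurable.ite ?_ measurable_snd.fst (hS.comp measurable_fst)
  exact measurableSet_le ((ENNReal.measurable_ofReal.comp measurable_snd.snd).mul (hq.comp (hS.comp measurable_fst)))
    measurable_const

omit [MeasurableSpace X] [MeasurableSpace Ω'] in
/-- Sections of the selector's preimages: for fixed `ω'` (with `w = S ω'`, `a = q w`),
`{(z, ξ) : T ∈ A} = (A × acc a) ∪ ({w ∈ A} × (acc a)ᶜ)`. [folklore] -/
theorem preimage_select_section (S : Ω' → X) (q : X → ℝ≥0∞) (c : ℝ≥0∞) (A : Set X) (ω' : Ω') :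
    Prod.mk ω' ⁻¹' ((fun p : Ω' × (X × ℝ) => if ENNReal.ofReal p.2.2 * q (S p.1) ≤ c then p.2.1 else S p.1) ⁻¹' A) =
      (A ×ˢ {ξ : ℝ | ENNReal.ofReal ξ * q (S ω') ≤ c}) ∪
        ({_z : X | S ω' ∈ A} ×ˢ {ξ : ℝ | ENNReal.ofReal ξ * q (S ω') ≤ c}ᶜ) := by
  ext ⟨z, ξ⟩
  simp only [mem_preimage, mem_union, mem_prod, mem_setOf_eq, mem_compl_iff]
  by_cases h : ENNReal.ofReal ξ * q (S ω') ≤ c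
  · simp [h]
  · simp [h]

omit [MeasurableSpace Ω'] in
/-- The measure of a section: `π(A) · m(a) + 𝟙_A(w) · (1 − m(a))`-shape, written with the acceptance set. [folklore] -/
theorem measure_select_section (π : Measure X) [IsProbabilityMeasure π] (S : Ω' → X) (q : X → ℝ≥0∞) (c : ℝ≥0∞)
    (A : Set X) (ω' : Ω') :
    (π.prod (volume.restrict (Icc (0 : ℝ) 1)))
        (Prod.mk ω' ⁻¹' ((fun p : Ω' × (X × ℝ) => if ENNReal.ofReal p.2.2 * q (S p.1) ≤ c then p.2.1 else S p.1) ⁻¹' A)) =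
      π A * (volume.restrict (Icc (0 : ℝ) 1)) {ξ : ℝ | ENNReal.ofReal ξ * q (S ω') ≤ c} +
        A.indicator 1 (S ω') * (volume.restrict (Icc (0 : ℝ) 1)) {ξ : ℝ | ENNReal.ofReal ξ * q (S ω') ≤ c}ᶜ := by
  haveI : IsProbabilityMeasure (volume.restrict (Icc (0 : ℝ) 1)) := ⟨by simp⟩
  rw [preimage_select_section]
  have hB : MeasurableSet {_z : X | S ω' ∈ A} := by
    by_cases h : S ω' ∈ A
    · simp [h]
    · simp [h]
  have hdisj : Disjoint (A ×ˢ {ξ : ℝ | ENNReal.ofReal ξ * q (S ω') ≤ c})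
      ({_z : X | S ω' ∈ A} ×ˢ {ξ : ℝ | ENNReal.ofReal ξ * q (S ω') ≤ c}ᶜ) := by
    rw [Set.disjoint_prod]
    exact Or.inr disjoint_compl_right
  rw [measure_union hdisj (hB.prod (measurableSet_acc _ c).compl), Measure.prod_prod, Measure.prod_prod]
  congr 1
  by_cases h : S ω' ∈ A
  · have : {_z : X | S ω' ∈ A} = univ := by ext; simp [h]
    rw [this, measure_univ, indicator_of_mem h, Pi.one_apply]
  · have : {_z : X | S ω' ∈ A} = ∅ := by ext; simp [h]
    rw [this, measure_empty, indicator_of_notMem h]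

/-- ★ **The randomised selector has the prescribed law.**  If `law(S) = q · π` under `μ` and `c ≤ q` `π`-a.e. (`c` finite),
then `T(ω', (z, ξ)) := if ξ·q(S ω') ≤ c then z else S ω'` has law `q · π` under `μ ⊗ (π ⊗ Leb|[0,1])`. [folklore] -/
theorem map_select_eq (μ : Measure Ω') [IsProbabilityMeasure μ] (π : Measure X) [IsProbabilityMeasure π]
    {S : Ω' → X} (hS : Measurable S) {q : X → ℝ≥0∞} (hq : Measurable q) {c : ℝ≥0∞} (hc : c ≠ ⊤)
    (hlaw : μ.map S = π.withDensity q) (hmin : ∀ᵐ w ∂π, c ≤ q w) :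
    (μ.prod (π.prod (volume.restrict (Icc (0 : ℝ) 1)))).map
        (fun p : Ω' × (X × ℝ) => if ENNReal.ofReal p.2.2 * q (S p.1) ≤ c then p.2.1 else S p.1) =
      π.withDensity q := by
  haveI : IsProbabilityMeasure (volume.restrict (Icc (0 : ℝ) 1)) := ⟨by simp⟩
  -- `q` is a.e. finite (its integral is `1`)
  have hqint : ∫⁻ w, q w ∂π = 1 := by
    have h := congrArg (fun ν : Measure X => ν univ) hlaw
    simp only [Measure.map_apply hS MeasurableSet.univ, preimage_univ, measure_univ, withDensity_apply _ MeasurableSet.univ,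
      Measure.restrict_univ] at h
    exact h.symm
  have hqfin : ∀ᵐ w ∂π, q w < ⊤ := ae_lt_top hq (by rw [hqint]; exact ENNReal.one_ne_top)
  -- abbreviations for the acceptance probabilities
  set m : ℝ≥0∞ → ℝ≥0∞ := fun a => (volume.restrict (Icc (0 : ℝ) 1)) {ξ : ℝ | ENNReal.ofReal ξ * a ≤ c} with hm
  set m' : ℝ≥0∞ → ℝ≥0∞ := fun a => (volume.restrict (Icc (0 : ℝ) 1)) {ξ : ℝ | ENNReal.ofReal ξ * a ≤ c}ᶜ with hm'
  have hmm : Measurable m := measurable_volume_acc c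
  have hm'eq : ∀ a, m' a = 1 - m a := fun a => prob_compl_eq_one_sub (measurableSet_acc a c)
  have hmm' : Measurable m' := by
    have : m' = fun a => 1 - m a := funext hm'eq
    rw [this]
    exact measurable_const.sub hmm
  -- the two a.e. identities `q·m(q) = c`, `q·m'(q) = q - c`
  have hae1 : ∀ᵐ w ∂π, q w * m (q w) = c := by
    filter_upwards [hmin, hqfin] with w h1 h2
    rw [hm]
    simp only []
    rw [mul_volume_acc (q w) c h2.ne hc, min_eq_right h1]
  have hae2 : ∀ᵐ w ∂π, q w * m' (q w) = q w - c := by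
    filter_upwards [hmin, hqfin] with w h1 h2
    rw [hm']
    simp only []
    rw [mul_volume_acc_compl (q w) c h2.ne hc, min_eq_right h1]
  ext A hA
  rw [Measure.map_apply (measurable_select hS hq c) hA, Measure.prod_apply (measurable_select hS hq c hA)]
  simp_rw [measure_select_section π S q c A]
  -- push forward along `S`, then use the density
  have hF : Measurable fun w : X => π A * m (q w) + A.indicator 1 w * m' (q w) :=
    (measurable_const.mul (hmm.comp hq)).add ((measurable_one.indicator hA).mul (hmm'.comp hq))
  have step1 : (∫⁻ ω', π A * m (q (S ω')) + A.indicator 1 (S ω') * m' (q (S ω')) ∂μ) =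
      ∫⁻ w, π A * m (q w) + A.indicator 1 w * m' (q w) ∂(μ.map S) := (lintegral_map hF hS).symm
  change (∫⁻ ω', π A * m (q (S ω')) + A.indicator 1 (S ω') * m' (q (S ω')) ∂μ) = (π.withDensity q) A
  rw [step1, hlaw, lintegral_withDensity_eq_lintegral_mul π hq hF, withDensity_apply q hA]
  -- compute with the a.e. identities
  have step2 : (fun w => (q * fun w => π A * m (q w) + A.indicator 1 w * m' (q w)) w) =ᵐ[π]
      fun w => π A * c + A.indicator (fun w => q w - c) w := by
    filter_upwards [hae1, hae2] with w h1 h2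
    simp only [Pi.mul_apply]
    rw [mul_add, ← mul_assoc, mul_comm (q w) (π A), mul_assoc, h1]
    congr 1
    by_cases hw : w ∈ A
    · rw [indicator_of_mem hw, indicator_of_mem hw, Pi.one_apply, one_mul, h2]
    · rw [indicator_of_notMem hw, indicator_of_notMem hw, zero_mul, mul_zero]
  rw [lintegral_congr_ae step2, lintegral_add_left (measurable_const), lintegral_const, measure_univ, mul_one,
    lintegral_indicator hA]
  -- `∫_A (q - c) = ∫_A q - c π(A)`
  have hsub : (∫⁻ w in A, q w - c ∂π) = (∫⁻ w in A, q w ∂π) - ∫⁻ _w in A, c ∂π := by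
    refine lintegral_sub measurable_const ?_ ?_
    · rw [lintegral_const, Measure.restrict_apply_univ]
      exact ENNReal.mul_ne_top hc (measure_ne_top _ _)
    · exact ae_restrict_of_ae hmin
  rw [hsub, lintegral_const, Measure.restrict_apply_univ, mul_comm c (π A)]
  refine add_tsub_cancel_of_le ?_
  calc π A * c = ∫⁻ _w in A, c ∂π := by rw [lintegral_const, Measure.restrict_apply_univ, mul_comm]
    _ ≤ ∫⁻ w in A, q w ∂π := lintegral_mono_ae (ae_restrict_of_ae hmin)

/-- The mean acceptance probability is `c`: `∫ m(q(S)) dμ = c`. [folklore] -/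
theorem lintegral_volume_acc_eq (μ : Measure Ω') [IsProbabilityMeasure μ] (π : Measure X) [IsProbabilityMeasure π]
    {S : Ω' → X} (hS : Measurable S) {q : X → ℝ≥0∞} (hq : Measurable q) {c : ℝ≥0∞} (hc : c ≠ ⊤)
    (hlaw : μ.map S = π.withDensity q) (hmin : ∀ᵐ w ∂π, c ≤ q w) :
    (∫⁻ ω', (volume.restrict (Icc (0 : ℝ) 1)) {ξ : ℝ | ENNReal.ofReal ξ * q (S ω') ≤ c} ∂μ) = c := by
  have hqint : ∫⁻ w, q w ∂π = 1 := by
    have h := congrArg (fun ν : Measure X => ν univ) hlaw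
    simp only [Measure.map_apply hS MeasurableSet.univ, preimage_univ, measure_univ, withDensity_apply _ MeasurableSet.univ,
      Measure.restrict_univ] at h
    exact h.symm
  have hqfin : ∀ᵐ w ∂π, q w < ⊤ := ae_lt_top hq (by rw [hqint]; exact ENNReal.one_ne_top)
  have hF : Measurable fun w : X => (volume.restrict (Icc (0 : ℝ) 1)) {ξ : ℝ | ENNReal.ofReal ξ * q w ≤ c} :=
    (measurable_volume_acc c).comp hq
  have step1 : (∫⁻ ω', (volume.restrict (Icc (0 : ℝ) 1)) {ξ : ℝ | ENNReal.ofReal ξ * q (S ω') ≤ c} ∂μ) =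
      ∫⁻ w, (volume.restrict (Icc (0 : ℝ) 1)) {ξ : ℝ | ENNReal.ofReal ξ * q w ≤ c} ∂(μ.map S) := (lintegral_map hF hS).symm
  rw [step1, hlaw, lintegral_withDensity_eq_lintegral_mul π hq hF]
  have hae : (fun w => (q * fun w => (volume.restrict (Icc (0 : ℝ) 1)) {ξ : ℝ | ENNReal.ofReal ξ * q w ≤ c}) w) =ᵐ[π]
      fun _ => c := by
    filter_upwards [hmin, hqfin] with w h1 h2
    simp only [Pi.mul_apply]
    rw [mul_volume_acc (q w) c h2.ne hc, min_eq_right h1]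
  rw [lintegral_congr_ae hae, lintegral_const, measure_univ, mul_one]

end Select

end Summit.QuantumFields.YangMills.Theorems.TransportPerturbation.DoeblinCoupling

end
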